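import Summits.BirchSwinnertonDyer.BirchSwinnertonDyer.Theses.ErratumRoadFive
import Summits.BirchSwinnertonDyer.BirchSwinnertonDyer.Theorems.ClassRecordThreeEulerHalvesAtThreeRefinedKolyvaginOfBSD
import Literature.NumberTheory.EllipticCurves.KolyvaginShaStructureDivisibility
import HarnessLib

/-!
# Line «minf_pinch» — crux `NonSurjCornerKolyZDeep` (stmt-BirchSwinnertonDyer-23046; ErratumRoadFive r601)

LINE-WRITER SKELETON (linewriter-bsd-display13-1 g0, 2026-08-31); NOT leaf progress; BSD is proved for no curve.

The crux (route decl `Theses.ErratumRoadFive.NonSurjCornerKolyZDeep` := the Theorems constant `Theorems.NonSurjCornerKolyZDeep`):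
on every DEEP classical frame `(K, Dt, β, ι)` of a DEEP corner pair `(E,p)` (`ClassX11b`, `ρ̄_{E,p}` not onto, `p ∈ {5,7}`,
`p ∣ ord_p Δ_min`, no (ram), `0 < ord_p #Ш_an(E)`; the conductor-`1` bottom point `y ∈ E(K)` lies in `p^{t+1}E(K)`,
`t = ord_p ∏_ℓ c_ℓ(E/ℚ)`), some level `M ≤ t` carries a Kolyvagin certificate `CertificateAt Dt β ι p M`.

CUT «`M_∞`-pinch, three engines» on McCallum's objects `Koly.Minf` / `Koly.CertificateAt` (all four stubs RESEARCH, no print stub):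
* (S1) `stub_kolyvaginNontrivialDeep` — `M_∞ ≠ ⊤` (Kolyvagin's conjecture at a non-surjective irreducible image, `p ∥ N`);
* (S2) `stub_kolyvaginUpperPinchDeep` — `M_∞ = m`, `p^{M₀} ∥ y` ⟹ `Ш(E/K)[p^∞]` finite and `ord_p #Ш(E/K)[p^∞] + 2m ≤ 2M₀`
  (Kolyvagin–McCallum Cor. 5.6, the Euler-system UPPER half, at `p ∈ B(E)`);
* (S3) `stub_shaLowerOverKDeep` — `Ш(E/K)[p^∞]` finite, `p^{M₀} ∥ y` ⟹ `2M₀ ≤ ord_p #Ш(E/K)[p^∞] + 2t` (the LOWER half of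
  `BSD_p(E/K)` in Gross–Zagier index form; Eisenstein / main-conjecture-`⊇` direction);
* (S4) `stub_higherRankLevelDeep` — `y` `p`-divisible to every depth (torsion bottom point: `r_an(E/K) ≥ 3` frames, which the item
  text includes — no twin-nonvanishing binder) and `M_∞ ≠ ⊤` ⟹ `M_∞ ≤ t` (Kolyvagin 1991 Conj. C/D territory).
Composition: if `y` has an exact exponent `M₀` then S1+S2+S3 pinch `m ≤ t` and the LANDED `Koly.certificateAt_of_minf_eq` gives the
certificate at level `m`; otherwise S1+S4. STATE OF PRINT (presearch 2026-08-31): for GOOD ORDINARY `p > 3`, `p` split in `K`,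
`E[p]` irreducible, Burungale–Castella–Grossi–Skinner 2023 (arXiv:2312.09301) prove Kolyvagin's conjecture (Thm. 1) AND W. Zhang's
refined form `M_∞ = Σ_ℓ ord_p c_ℓ` in all ranks (Thm. 2) — i.e. this crux verbatim but at good `p`; the whole research content of the
line is the MULTIPLICATIVE case `p ∥ N` (with `p ∣ ord_pΔ`, small irreducible image), stub by stub.
-/

set_option autoImplicit false
set_option linter.dupNamespace false

noncomputable section

open scoped Classical NumberField MatrixGroups ModularForm

namespace Summit.BirchSwinnertonDyer.BirchSwinnertonDyer.Cruxes.NonSurjCornerKolyZDeep.MinfPinch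

open CongruenceSubgroup WeierstrassCurve NumberField IsDedekindDomain Field
  Literature.NumberTheory.EllipticCurves
  Literature.NumberTheory.EllipticCurves.ModularForms
  Literature.NumberTheory.EllipticCurves.Rank1Residual
  Literature.NumberTheory.QuadraticFields.Quadratic
  Summit.BirchSwinnertonDyer.Rank1Residual
  Summit.BirchSwinnertonDyer.Rank1Residual.X11b.Three.Koly

/-! ## Stubs (all RESEARCH) -/

/-- **[research] (S1) `stub_kolyvaginNontrivialDeep` — Kolyvagin's conjecture on the deep corner frames:** the Kolyvagin
system of `(Dt, β, ι)` at `p` is non-trivial at SOME level, `M_∞ ≠ ⊤` (some square-free product `n` of Kolyvagin primes of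
index `≥ M+1` and a datum with `P_n ∉ p^{M+1}E(K[n])`, for some `M`). IN PRINT for `p > 3` of GOOD ORDINARY reduction split in `K`,
`E[p]` irreducible (surjectivity no longer needed), `D_K` odd: Burungale–Castella–Grossi–Skinner 2023 Thm. 1 (arXiv:2312.09301;
earlier W. Zhang 2014 Thm. 1.1 under (sur), Sweeting 2020 by ultrapatching). Here `p ∥ N` (multiplicative): NOT covered. Why it might
fail: BCGS's inputs — the rational anticyclotomic main conjecture and the Kolyvagin-system bound «with error terms» for twists
`α ≡ 1 (p^m)` — are stated for good ordinary `p`; the multiplicative adaptation (cf. Skinner 2016 on the cyclotomic side) is unwritten,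
and even `D_K` may be here. [cite: BCGS2023NonvanishingKolyvagin, Thm. 1 (arXiv:2312.09301 §0.1)] [cite: WZhang2014, Thm. 1.1 (p. 195)]
[cite: Sweeting2020, Thm. A (arXiv:2012.11771)] [cite: Kolyvagin1991MathAnn, Conj. A] -/
theorem stub_kolyvaginNontrivialDeep :
    ∀ (W : WeierstrassCurve ℚ) [W.IsElliptic] [W.IsGloballyMinimal] (p : ℕ) [Fact p.Prime]
      (N : ℕ) [NeZero N] (K : Type) [Field K] [NumberField K]
      (Dt : ModularParametrizationData W N) (β : ℤ) (ι : K →+* ℂ),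
      ClassX11b W p → ¬ Surj W p → (p = 5 ∨ p = 7) → p ∣ padicValInt p W.minimalDiscriminantInt →
      ¬ Ram W p → (∃ s : ℚ, shaAn W = (s : ℂ) ∧ 0 < padicValRat p s) →
      W.conductorNorm ℤ = N → IsImaginaryQuadratic K →
      4 < (NumberField.discr K).natAbs → SatisfiesHeegnerHypothesis N K →
      SatisfiesHeegnerHypothesis p K → (4 * (N : ℤ)) ∣ β ^ 2 - NumberField.discr K → ¬ (p : ℤ) ∣ Dt.c →
      (∃ (d₁ : KolyvaginHeegnerData Dt β ι 1) (y : (W.baseChange K).toAffine.Point),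
        WeierstrassCurve.Affine.Point.map (W' := W) (algebraMap K (ringClassField K ι 1)).toRatAlgHom y =
          d₁.derivedPoint ∧
        ∃ Q : (W.baseChange K).toAffine.Point, ((p ^ (padicValNat p W.tamagawaProduct + 1) : ℕ) : ℤ) • Q = y) →
      Minf Dt β ι p ≠ ⊤ := by
  sorry

/-- **[research] (S2) `stub_kolyvaginUpperPinchDeep` — the Euler-system UPPER half of Kolyvagin–McCallum at a non-surjective
`p`:** on a deep corner frame, if `M_∞ = m` is finite and the bottom point `y ∈ E(K)` over `P_1` has exact exponent `M₀`
(`y ∈ p^{M₀}E(K) ∖ p^{M₀+1}E(K)`), then `Ш(E/K)[p^∞]` is finite and `ord_p #Ш(E/K)[p^∞] + 2m ≤ 2M₀` (McCallum 1991 Cor. 5.6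
«`ord_p|Ш(E/K)| = 2(M₀ − m)`», the `≤` half, with Thm. 5.4 finiteness). Printed for `p ∉ B(E)` (image of `ρ_{E,p^∞}` large); with
S3 and S4 it is the `p ∥ N` analogue of BCGS 2023 Thm. 2 («`M_∞ = Σ_ℓ ord_p c_ℓ`», good ordinary `p > 3`, `E[p]` irreducible, ALL ranks);
the tree's named fact `McCallum1991_padicValNat_card_sha_primary_add_le_of_globalDivisibility` is the OTHER half and displays
`ρ̄_{E,p^n}` onto for all `n`. Why it might fail: at non-surjective `p` Kolyvagin's Čebotarev/eigen-decomposition step needs a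
replacement (the image must move the derived classes enough); `p ∈ B(E)` is exactly the excluded set; BCGS's route avoids the
structure theorem but needs good ordinary `p`. [cite: McCallumLMS1991, §5 Thm. 5.4 (p. 308), Cor. 5.6 (p. 310)]
[cite: Kolyvagin1991MathAnn, §1 (B(E), p. 254)] [cite: BCGS2023NonvanishingKolyvagin, Thm. 2 (arXiv:2312.09301 §0.1)] -/
theorem stub_kolyvaginUpperPinchDeep :
    ∀ (W : WeierstrassCurve ℚ) [W.IsElliptic] [W.IsGloballyMinimal] (p : ℕ) [Fact p.Prime]
      (N : ℕ) [NeZero N] (K : Type) [Field K] [NumberField K]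
      (Dt : ModularParametrizationData W N) (β : ℤ) (ι : K →+* ℂ),
      ClassX11b W p → ¬ Surj W p → (p = 5 ∨ p = 7) → p ∣ padicValInt p W.minimalDiscriminantInt →
      ¬ Ram W p → (∃ s : ℚ, shaAn W = (s : ℂ) ∧ 0 < padicValRat p s) →
      W.conductorNorm ℤ = N → IsImaginaryQuadratic K →
      4 < (NumberField.discr K).natAbs → SatisfiesHeegnerHypothesis N K →
      SatisfiesHeegnerHypothesis p K → (4 * (N : ℤ)) ∣ β ^ 2 - NumberField.discr K → ¬ (p : ℤ) ∣ Dt.c →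
      ∀ (d₁ : KolyvaginHeegnerData Dt β ι 1) (y : (W.baseChange K).toAffine.Point),
        WeierstrassCurve.Affine.Point.map (W' := W) (algebraMap K (ringClassField K ι 1)).toRatAlgHom y =
          d₁.derivedPoint →
      ∀ (M₀ : ℕ), (∃ Q : (W.baseChange K).toAffine.Point, ((p ^ M₀ : ℕ) : ℤ) • Q = y) →
        (¬ ∃ Q : (W.baseChange K).toAffine.Point, ((p ^ (M₀ + 1) : ℕ) : ℤ) • Q = y) →
      ∀ (m : ℕ), Minf Dt β ι p = (m : ℕ∞) →
        Finite (AddCommGroup.primaryComponent (W.baseChange K).sha p) ∧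
          padicValNat p (Nat.card (AddCommGroup.primaryComponent (W.baseChange K).sha p)) + 2 * m ≤ 2 * M₀ := by
  sorry

/-- **[research] (S3) `stub_shaLowerOverKDeep` — the LOWER half of `BSD_p(E/K)` in Gross–Zagier index form:** on a deep corner
frame with `Ш(E/K)[p^∞]` finite and `p^{M₀} ∥ y`, `2M₀ ≤ ord_p #Ш(E/K)[p^∞] + 2t` — i.e. `ord_p #Ш(E/K)[p^∞] ≥ ord_p #Ш_an(E/K)`
read through `M₀ = ord_p[E(K) : ℤy_K] = t + ord_p c + ½ord_p #Ш_an(E/K)` (Gross–Zagier; `p ∤ c(Dt)`, `E(K)[p] = 0`, every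
`ℓ ∣ N` split in `K`). Technique: the Eisenstein / main-conjecture `⊇` direction (Skinner–Urban 2014 three-variable IMC with
Skinner 2016 at `p ∥ N`, descended to `K`), not an Euler system. Why it might fail: SU needs `ρ̄` irreducible AND ramified at some
`ℓ ∥ N`, `ℓ ≠ p` — not given on the corner — and the passage from the cyclotomic/`K`-main conjecture to the exact index bound at a
non-surjective `p` with `p ∣ ord_pΔ` (Tamagawa factor at `p` itself) is unwritten. [cite: SkinnerUrban2014, Thm. 3.29]
[cite: Skinner2016PJM, Thm. A] [cite: GrossZagier1986, Thm. I.6.3] [cite: Jetchev2008, Cor. 1.5 (p. 812)] -/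
theorem stub_shaLowerOverKDeep :
    ∀ (W : WeierstrassCurve ℚ) [W.IsElliptic] [W.IsGloballyMinimal] (p : ℕ) [Fact p.Prime]
      (N : ℕ) [NeZero N] (K : Type) [Field K] [NumberField K]
      (Dt : ModularParametrizationData W N) (β : ℤ) (ι : K →+* ℂ),
      ClassX11b W p → ¬ Surj W p → (p = 5 ∨ p = 7) → p ∣ padicValInt p W.minimalDiscriminantInt →
      ¬ Ram W p → (∃ s : ℚ, shaAn W = (s : ℂ) ∧ 0 < padicValRat p s) →
      W.conductorNorm ℤ = N → IsImaginaryQuadratic K →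
      4 < (NumberField.discr K).natAbs → SatisfiesHeegnerHypothesis N K →
      SatisfiesHeegnerHypothesis p K → (4 * (N : ℤ)) ∣ β ^ 2 - NumberField.discr K → ¬ (p : ℤ) ∣ Dt.c →
      ∀ (d₁ : KolyvaginHeegnerData Dt β ι 1) (y : (W.baseChange K).toAffine.Point),
        WeierstrassCurve.Affine.Point.map (W' := W) (algebraMap K (ringClassField K ι 1)).toRatAlgHom y =
          d₁.derivedPoint →
      ∀ (M₀ : ℕ), (∃ Q : (W.baseChange K).toAffine.Point, ((p ^ M₀ : ℕ) : ℤ) • Q = y) →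
        (¬ ∃ Q : (W.baseChange K).toAffine.Point, ((p ^ (M₀ + 1) : ℕ) : ℤ) • Q = y) →
      Finite (AddCommGroup.primaryComponent (W.baseChange K).sha p) →
        2 * M₀ ≤ padicValNat p (Nat.card (AddCommGroup.primaryComponent (W.baseChange K).sha p)) +
          2 * padicValNat p W.tamagawaProduct := by
  sorry

/-- **[research] (S4) `stub_higherRankLevelDeep` — level control on the frames with TORSION bottom point:** if `y` is
`p`-divisible to every depth (with `E(K)[p] = 0`: `y_K` torsion, i.e. `L'(E/K,1) = 0`, `r_an(E/K) ≥ 3` — frames the item text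
includes, since it carries no `L(E^{(d_K)},1) ≠ 0` binder) and the Kolyvagin system is non-trivial, then `M_∞ ≤ t`. In print for
GOOD ORDINARY `p > 3`, `E[p]` irreducible, in ALL ranks: BCGS 2023 Thm. 2 «`M_∞ = Σ_ℓ ord_p c_ℓ`» (W. Zhang's refined conjecture);
at `p ∥ N` nothing pins `M_∞` on these frames (no `M₀` to pinch against). These are exactly the frames NOT consumed by the route's glue `NonSurjCornerOfItems`
(which instantiates the item only at Friedberg–Hoffstein frames with `L(E^{(d_K)},1) ≠ 0`; route pen g53 09:00:09Z). Why it might fail: the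
multiplicative analogue of BCGS Thm. 2 needs their anticyclotomic IMC with error terms at `p ∥ N` — unwritten; a frame with
`r_an(E/K) = 3` and `M_∞ = t + 1` contradicts nothing known at multiplicative `p`. FLAG for the route pen: if the twin-nonvanishing binder was intended, this stub is moot.
[cite: BCGS2023NonvanishingKolyvagin, Thm. 2 and Cor. 1 (arXiv:2312.09301)] [cite: Kolyvagin1991MathAnn, Conj. C] [cite: WZhang2014, §1] -/
theorem stub_higherRankLevelDeep :
    ∀ (W : WeierstrassCurve ℚ) [W.IsElliptic] [W.IsGloballyMinimal] (p : ℕ) [Fact p.Prime]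
      (N : ℕ) [NeZero N] (K : Type) [Field K] [NumberField K]
      (Dt : ModularParametrizationData W N) (β : ℤ) (ι : K →+* ℂ),
      ClassX11b W p → ¬ Surj W p → (p = 5 ∨ p = 7) → p ∣ padicValInt p W.minimalDiscriminantInt →
      ¬ Ram W p → (∃ s : ℚ, shaAn W = (s : ℂ) ∧ 0 < padicValRat p s) →
      W.conductorNorm ℤ = N → IsImaginaryQuadratic K →
      4 < (NumberField.discr K).natAbs → SatisfiesHeegnerHypothesis N K →
      SatisfiesHeegnerHypothesis p K → (4 * (N : ℤ)) ∣ β ^ 2 - NumberField.discr K → ¬ (p : ℤ) ∣ Dt.c →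
      ∀ (d₁ : KolyvaginHeegnerData Dt β ι 1) (y : (W.baseChange K).toAffine.Point),
        WeierstrassCurve.Affine.Point.map (W' := W) (algebraMap K (ringClassField K ι 1)).toRatAlgHom y =
          d₁.derivedPoint →
      (∀ M : ℕ, ∃ Q : (W.baseChange K).toAffine.Point, ((p ^ M : ℕ) : ℤ) • Q = y) →
      Minf Dt β ι p ≠ ⊤ → Minf Dt β ι p ≤ ((padicValNat p W.tamagawaProduct : ℕ) : ℕ∞) := by
  sorry

/-! ## Composition (sorry-free): the four stubs + the landed `Koly.certificateAt_of_minf_eq` give the crux BY NAME -/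

/-- **`NonSurjCornerKolyZDeep_of`.** Case `y` has an exact `p`-exponent `M₀`: S1 gives `M_∞ = m`, S2 and S3 pinch `2m ≤ 2t`, and
`certificateAt_of_minf_eq` yields the certificate at level `m ≤ t`. Case `y` divisible to every depth: S1 + S4. -/
theorem NonSurjCornerKolyZDeep_of :
    Summit.BirchSwinnertonDyer.BirchSwinnertonDyer.Theses.ErratumRoadFive.NonSurjCornerKolyZDeep := by
  show Summit.BirchSwinnertonDyer.BirchSwinnertonDyer.Theorems.NonSurjCornerKolyZDeep
  intro W _ _ p _ N _ K _ _ Dt β ι hX hS hp57 hΔ hR hsha hN hK hd hHN hHp hβ hc hdeep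
  -- S1: the Kolyvagin system is non-trivial, `M_∞ = m`
  have hne : Minf Dt β ι p ≠ ⊤ :=
    stub_kolyvaginNontrivialDeep W p N K Dt β ι hX hS hp57 hΔ hR hsha hN hK hd hHN hHp hβ hc hdeep
  obtain ⟨m, hm⟩ := ENat.ne_top_iff_exists.mp hne
  obtain ⟨d₁, y, hy, -⟩ := hdeep
  suffices hmt : m ≤ padicValNat p W.tamagawaProduct from
    ⟨m, hmt, certificateAt_of_minf_eq Dt β ι p hm.symm⟩
  by_cases hall : ∀ M : ℕ, ∃ Q : (W.baseChange K).toAffine.Point, ((p ^ M : ℕ) : ℤ) • Q = y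
  · -- torsion bottom point: S4
    have h4 := stub_higherRankLevelDeep W p N K Dt β ι hX hS hp57 hΔ hR hsha hN hK hd hHN hHp hβ hc d₁ y hy hall hne
    rw [← hm] at h4
    exact_mod_cast h4
  · -- exact exponent `M₀`: S2 + S3
    push Not at hall
    obtain ⟨M₁, hM₁⟩ := hall
    -- the least non-divisibility level is positive (level 0 is trivially divisible), so it is `M₀ + 1`
    have hex : ∃ M : ℕ, ∀ Q : (W.baseChange K).toAffine.Point, ((p ^ M : ℕ) : ℤ) • Q ≠ y := ⟨M₁, hM₁⟩
    have h0 : Nat.find hex ≠ 0 := by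
      intro h0
      have := Nat.find_spec hex y
      rw [h0] at this
      exact this (by simp)
    obtain ⟨M₀, hM₀⟩ : ∃ M₀, Nat.find hex = M₀ + 1 := Nat.exists_eq_succ_of_ne_zero h0
    have hdiv : ∃ Q : (W.baseChange K).toAffine.Point, ((p ^ M₀ : ℕ) : ℤ) • Q = y := by
      have hlt : M₀ < Nat.find hex := by omega
      have := Nat.find_min hex hlt
      push Not at this
      exact this
    have hndiv : ¬ ∃ Q : (W.baseChange K).toAffine.Point, ((p ^ (M₀ + 1) : ℕ) : ℤ) • Q = y := by
      rintro ⟨Q, hQ⟩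
      have := Nat.find_spec hex Q
      rw [hM₀] at this
      exact this hQ
    obtain ⟨hfin, hup⟩ := stub_kolyvaginUpperPinchDeep W p N K Dt β ι hX hS hp57 hΔ hR hsha hN hK hd hHN hHp hβ hc
      d₁ y hy M₀ hdiv hndiv m hm.symm
    have hlow := stub_shaLowerOverKDeep W p N K Dt β ι hX hS hp57 hΔ hR hsha hN hK hd hHN hHp hβ hc
      d₁ y hy M₀ hdiv hndiv hfin
    omega

end Summit.BirchSwinnertonDyer.BirchSwinnertonDyer.Cruxes.NonSurjCornerKolyZDeep.MinfPinch

end
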